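import Literature.NumberTheory.Automorphic.UnitaryGroupTorusIdeleUnfolding
import Literature.NumberTheory.Automorphic.UnitaryGroupTorusRayTwo
import HarnessLib

/-!
# Torus-to-idele unfolding for `U(J₂)`: `∫_{T(F)∖T(𝔸_F)} G(d₀ t) dt = C · ∫_{E^×∖𝕀_E} G(x) dx` — the torus IS the idele group
(Rogawski, *Automorphic Representations of Unitary Groups in Three Variables* (1990), §7.3 p. 98 «Let `G = U(3)`, `U(2)`, or
`U(2) × U(1)` … the integral over `MS∖M`» and Prop. 7.3.1 (the unipotent term for `U(2)`, `U(2) × U(1)`); Folland (1995), §2.6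
Thm. 2.49 for the underlying Weil formula.)

Topic `NumberTheory/Automorphic`; namespace `Literature.NumberTheory.Automorphic.UnitaryGroup`. THEOREMS ONLY (no definition,
no named fact, no instance, no notation, no `sorry`). H-side copy at `N = 2` of ★ `UnitaryGroupTorusIdeleUnfolding` (row (C-torus)
of the `U(J₃)` road; cell `pub/hodgecm-mathlib`, crux H413, census `CENSUS-LAWS-Hside` §3 (σ-u) «`TorusLineUnfoldingTwo`»): for the
diagonal torus `T(𝔸_F) = {diag(d₀, d₁) : c(d₀) d₁ = 1}` of `U(J₂)` the first coordinate

  `d₀ : T(𝔸_F) →* 𝕀_E`, `t = diag(d₀, (c d₀)⁻¹) ↦ d₀` (inline `MonoidHom.mk'` over ★ `diagUnit`; no definition),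

is an ISOMORPHISM of topological groups (★ `exists_torus_diagUnit_eq_two`, ★ `eq_of_diagUnit_zero_eq_two`,
★ `continuous_diagUnit_torus_two`, the open mapping theorem) carrying the rational torus `Γ_T` onto the principal ideles `E^×`
(★ `exists_rational_torus_two`). Hence the generic unfolding ★ `CoveringWeightsPushforward` applies with TRIVIAL fibre (no `U(1)`
factor, no Godement covolume — the rank-one simplification of the `U(J₃)` file's §2):

* §1 `diagUnit_torus_mul_two`, `continuous_diagUnitZeroHom_two`, `diagUnitZeroHom_two_surjective`, `diagUnitZeroHom_two_injective`,
  `isOpenMap_diagUnitZeroHom_two`, `map_rationalTorusInBorel_diagUnitZero_eq_principalIdeles_two`, `discreteTopology_rationalTorusInBorel_two`;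
* §2 `exists_isCoveringWeight_ker_diagUnitZero_two` — the (trivial) fibre has a covering weight of finite Haar integral;
* §3 **`exists_lintegral_comp_diagUnitZero_mul_weight_eq_two`** — `∃ C ∈ (0,∞)`, for every `Γ_T`-covering weight `w`, every
  `E^×`-covering weight `wE` and every Borel `E^×`-invariant `G ≥ 0`: `∫⁻ G(d₀ t) w(t) dμT = C · ∫⁻ G(x) wE(x) dμE`;
  **`exists_lintegral_comp_diagUnitZero_mul_weight_eq_setLIntegral_two`** — the same against an idele class domain `𝓕 ⊆ 𝕀_E`.

The norm step `N_{E∕F} ∘ d₀ : T(𝔸_F) → 𝕀_F` (the line action `Ad d(a) · n(b) = n(N(a) b)`, image `F^× · N𝕀_E` of index two)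
composes §3 with ★ `IdeleNormUnfoldingQuadratic` exactly as ★ `UnitaryGroupTorusCentreUnfolding` does at `N = 3` (sequel file).
HC_CM is proved only modulo the printed citations until rung 0 closes — nothing here bears on a summit statement.

## References
* J. D. Rogawski, *Automorphic Representations of Unitary Groups in Three Variables*, Ann. of Math. Stud. 123 (1990), §1.10,
  §7.3 (p. 98), Prop. 7.3.1 (p. 97) [Rogawski1990].
* G. B. Folland, *A Course in Abstract Harmonic Analysis* (1995), §2.6 Thm. 2.49 [Folland1995].
-/

set_option autoImplicit false

noncomputable section

open MeasureTheory Measure NumberField IsDedekindDomain Set Literature.MeasureTheory.Group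
open scoped ENNReal NNReal

namespace Literature.NumberTheory.Automorphic

namespace UnitaryGroup

variable {F E : Type} [Field F] [NumberField F] [Field E] [NumberField E] [Algebra F E] {c : E ≃ₐ[F] E}

/-! ## §1 The coordinate `d₀ : T(𝔸_F) →* 𝕀_E` of the torus of `U(J₂)` is an isomorphism -/

section Projection

/-- Diagonal entries of a product of torus elements of `U(J₂)` multiply (the `N = 2` sibling of ★ `diagUnit_torus_mul`).
[cite: Rogawski1990, §1.10] -/
theorem diagUnit_torus_mul_two (t t' : torusInBorel F E c 2) (i : Fin 2) :
    diagUnit ((t * t' : torusInBorel F E c 2) : borelAdelic F E c 2).2 i =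
      diagUnit (t : borelAdelic F E c 2).2 i * diagUnit (t' : borelAdelic F E c 2).2 i := by
  have ht : torusPart (t : borelAdelic F E c 2) = t := (mem_torusInBorel_iff_torusPart_eq _).1 t.2
  have ht' : torusPart (t' : borelAdelic F E c 2) = t' := (mem_torusInBorel_iff_torusPart_eq _).1 t'.2
  refine Units.ext ?_
  rw [Subgroup.coe_mul, coe_diagUnit, Units.val_mul, coe_diagUnit, coe_diagUnit]
  change (adelicVal F E c 2 _ (((t : borelAdelic F E c 2) : (quasiSplit F E c 2).Adelic) *
      ((t' : borelAdelic F E c 2) : (quasiSplit F E c 2).Adelic)) : Matrix (Fin 2) (Fin 2) (AdeleRing (𝓞 E) E)) i i = _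
  rw [map_mul, Units.val_mul, adelicVal_eq_glDiagonal_diagUnit ht, adelicVal_eq_glDiagonal_diagUnit ht', coe_glDiagonal,
    coe_glDiagonal, Matrix.diagonal_mul_diagonal, Matrix.diagonal_apply_eq, Matrix.diagonal_apply_eq,
    Matrix.diagonal_apply_eq]

/-- `d₀` as a homomorphism evaluates to the first diagonal idele (definitional). [cite: Rogawski1990, §1.10] -/
theorem diagUnitZeroHom_two_apply (t : torusInBorel F E c 2) :
    (MonoidHom.mk' (fun t : torusInBorel F E c 2 => diagUnit (t : borelAdelic F E c 2).2 0)
      (fun t t' => diagUnit_torus_mul_two t t' 0)) t = diagUnit (t : borelAdelic F E c 2).2 0 := rfl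

/-- **`d₀` is continuous** on `T(𝔸_F)` of `U(J₂)` (★ `continuous_diagUnit_torus_two`). [cite: Rogawski1990, §1.10] -/
theorem continuous_diagUnitZeroHom_two :
    Continuous (MonoidHom.mk' (fun t : torusInBorel F E c 2 => diagUnit (t : borelAdelic F E c 2).2 0)
      (fun t t' => diagUnit_torus_mul_two t t' 0)) :=
  continuous_diagUnit_torus_two (F := F) (E := E) (c := c) 0

/-- **`d₀` is surjective**: `diag(a, (c a)⁻¹) ↦ a` (★ `exists_torus_diagUnit_eq_two`). [cite: Rogawski1990, §1.10] -/
theorem diagUnitZeroHom_two_surjective (hc : c * c = 1) :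
    Function.Surjective (MonoidHom.mk' (fun t : torusInBorel F E c 2 => diagUnit (t : borelAdelic F E c 2).2 0)
      (fun t t' => diagUnit_torus_mul_two t t' 0)) := by
  intro a
  obtain ⟨t, -, h0⟩ := exists_torus_diagUnit_eq_two (F := F) hc a
  exact ⟨t, h0⟩

/-- **`d₀` is injective** on `T(𝔸_F)` of `U(J₂)`: a torus element is determined by `d₀` (`d₁ = (c d₀)⁻¹`,
★ `eq_of_diagUnit_zero_eq_two`) — the rank-one feature: NO `U(1)` fibre. [cite: Rogawski1990, §1.10] -/
theorem diagUnitZeroHom_two_injective :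
    Function.Injective (MonoidHom.mk' (fun t : torusInBorel F E c 2 => diagUnit (t : borelAdelic F E c 2).2 0)
      (fun t t' => diagUnit_torus_mul_two t t' 0)) :=
  fun _ _ h => eq_of_diagUnit_zero_eq_two h

/-- `T(𝔸_F)` of `U(J₂)` is locally compact, second countable and Hausdorff (closed subgroup of `B(𝔸_F)`, ★ `isTopSemidirect_borelAdelic`).
[cite: Rogawski1990, §1.10] -/
theorem locallyCompactSpace_secondCountable_t2_torusInBorel_two :
    LocallyCompactSpace (torusInBorel F E c 2) ∧ SecondCountableTopology (torusInBorel F E c 2) ∧ T2Space (torusInBorel F E c 2) := by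
  haveI := locallyCompactSpace_borelAdelic (F := F) (E := E) (c := c) (N := 2)
  haveI := secondCountableTopology_borelAdelic (F := F) (E := E) (c := c) (N := 2)
  haveI := t2Space_borelAdelic (F := F) (E := E) (c := c) (N := 2)
  exact ⟨(isTopSemidirect_borelAdelic (F := F) (E := E) (c := c) (N := 2)).isClosed_left.locallyCompactSpace,
    TopologicalSpace.Subtype.secondCountableTopology _, inferInstance⟩

/-- **`d₀` is an open map** (open mapping theorem for the continuous surjective homomorphism `d₀` of the σ-compact `T(𝔸_F)` onto
the locally compact `𝕀_E`, Mathlib `MonoidHom.isOpenMap_of_sigmaCompact`). [cite: Folland1995, §2.6] -/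
theorem isOpenMap_diagUnitZeroHom_two (hc : c * c = 1) :
    IsOpenMap (MonoidHom.mk' (fun t : torusInBorel F E c 2 => diagUnit (t : borelAdelic F E c 2).2 0)
      (fun t t' => diagUnit_torus_mul_two t t' 0)) := by
  obtain ⟨hT1, hT2, hT3⟩ := locallyCompactSpace_secondCountable_t2_torusInBorel_two (F := F) (E := E) (c := c)
  obtain ⟨hI1, hI2, hI3⟩ := locallyCompactSpace_secondCountable_t2_idele (E := E)
  exact MonoidHom.isOpenMap_of_sigmaCompact _ (diagUnitZeroHom_two_surjective hc) continuous_diagUnitZeroHom_two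

/-- The first diagonal entry of a RATIONAL torus element of `U(J₂)` is a principal idele. [cite: Rogawski1990, §1.10] -/
theorem diagUnit_zero_mem_principalIdeles_of_mem_two (τ : ((rationalBorel F E c 2).subgroupOf (torusInBorel F E c 2))) :
    diagUnit (((τ : (torusInBorel F E c 2)) : borelAdelic F E c 2)).2 0 ∈ GaloisRepresentations.principalIdeles E := by
  obtain ⟨γ, hγ⟩ := (τ.2 : (((τ : (torusInBorel F E c 2)) : borelAdelic F E c 2) : (quasiSplit F E c 2).Adelic) ∈
    (quasiSplit F E c 2).arithmeticSubgroup)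
  have hγ' : (((τ : (torusInBorel F E c 2)) : borelAdelic F E c 2) : (quasiSplit F E c 2).Adelic) = (quasiSplit F E c 2).toAdelic γ := hγ.symm
  have hval : ((diagUnit (((τ : (torusInBorel F E c 2)) : borelAdelic F E c 2)).2 0 : (AdeleRing (𝓞 E) E)ˣ) : AdeleRing (𝓞 E) E) =
      algebraMap E (AdeleRing (𝓞 E) E) (((γ.val : GL (Fin 2) E) : Matrix (Fin 2) (Fin 2) E) 0 0) := by
    have h1 : ((diagUnit (((τ : (torusInBorel F E c 2)) : borelAdelic F E c 2)).2 0 : (AdeleRing (𝓞 E) E)ˣ) : AdeleRing (𝓞 E) E) =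
        ((adelicVal F E c 2 _ (((τ : (torusInBorel F E c 2)) : borelAdelic F E c 2) : (quasiSplit F E c 2).Adelic) :
          GL (Fin 2) (AdeleRing (𝓞 E) E)) : Matrix (Fin 2) (Fin 2) (AdeleRing (𝓞 E) E)) 0 0 := rfl
    rw [h1, hγ']
    rfl
  haveI : Nontrivial (AdeleRing (𝓞 E) E) := (AdeleRing.algebraMap_injective (𝓞 E) E).nontrivial
  have hne : (((γ.val : GL (Fin 2) E) : Matrix (Fin 2) (Fin 2) E) 0 0) ≠ 0 := by
    intro h0
    have h1 := (diagUnit (((τ : (torusInBorel F E c 2)) : borelAdelic F E c 2)).2 0).ne_zero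
    rw [hval, h0, map_zero] at h1
    exact h1 rfl
  refine ⟨Units.mk0 _ hne, Units.ext ?_⟩
  rw [hval]
  rfl

/-- **`d₀(Γ_T) = Eˣ`** for `U(J₂)`: the rational torus maps ONTO the principal ideles (`⊆`: entries of a rational matrix are rational;
`⊇`: `diag(k, (c k)⁻¹) ∈ T(F)`, ★ `exists_rational_torus_two`). [cite: Rogawski1990, §1.10] -/
theorem map_rationalTorusInBorel_diagUnitZero_eq_principalIdeles_two (hc : c * c = 1) :
    ((rationalBorel F E c 2).subgroupOf (torusInBorel F E c 2)).map
        (MonoidHom.mk' (fun t : torusInBorel F E c 2 => diagUnit (t : borelAdelic F E c 2).2 0)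
          (fun t t' => diagUnit_torus_mul_two t t' 0)) = GaloisRepresentations.principalIdeles E := by
  ext x
  constructor
  · rintro ⟨τ, hτ, rfl⟩
    exact diagUnit_zero_mem_principalIdeles_of_mem_two ⟨τ, hτ⟩
  · rintro ⟨k, rfl⟩
    obtain ⟨τ, hτA, hτT, hτ0⟩ := exists_rational_torus_two (F := F) (c := c)
      (fun x => by rw [← AlgEquiv.mul_apply, hc, AlgEquiv.one_apply]) k
    refine ⟨⟨τ, (mem_torusInBorel_iff_torusPart_eq τ).2 hτT⟩, hτA, ?_⟩
    rw [diagUnitZeroHom_two_apply]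
    exact hτ0

/-- **The rational torus `Γ_T` of `U(J₂)` is discrete** (it embeds continuously in the discrete `G(F)`, ★ `isDiscreteRational_quasiSplit`).
[cite: Rogawski1990, §1.10] -/
theorem discreteTopology_rationalTorusInBorel_two :
    DiscreteTopology ((rationalBorel F E c 2).subgroupOf (torusInBorel F E c 2)) := by
  haveI : DiscreteTopology (quasiSplit F E c 2).arithmeticSubgroup := isDiscreteRational_quasiSplit
  refine DiscreteTopology.of_continuous_injective
    (f := fun τ : ((rationalBorel F E c 2).subgroupOf (torusInBorel F E c 2)) =>
      (⟨(((τ : (torusInBorel F E c 2)) : borelAdelic F E c 2) : (quasiSplit F E c 2).Adelic), τ.2⟩ :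
        (quasiSplit F E c 2).arithmeticSubgroup)) ?_ ?_
  · exact Continuous.subtype_mk (continuous_subtype_val.comp (continuous_subtype_val.comp continuous_subtype_val)) _
  · intro τ τ' h
    have h' := congrArg (fun z : (quasiSplit F E c 2).arithmeticSubgroup => (z : (quasiSplit F E c 2).Adelic)) h
    exact Subtype.ext (Subtype.ext (Subtype.ext h'))

end Projection

/-! ## §2 The fibre `ker d₀` is TRIVIAL: a covering weight of finite Haar integral for free -/

section Fibre

/-- **`ker d₀ = {1}`** on `T(𝔸_F)` of `U(J₂)` (injectivity): the kernel is a subsingleton. [cite: Rogawski1990, §1.10] -/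
theorem subsingleton_ker_diagUnitZeroHom_two :
    Subsingleton (MonoidHom.mk' (fun t : torusInBorel F E c 2 => diagUnit (t : borelAdelic F E c 2).2 0)
      (fun t t' => diagUnit_torus_mul_two t t' 0)).ker := by
  refine ⟨fun a b => Subtype.ext (diagUnitZeroHom_two_injective (F := F) (E := E) (c := c) ?_)⟩
  rw [(MonoidHom.mem_ker).1 a.2, (MonoidHom.mem_ker).1 b.2]

/-- **The trivial fibre has a covering weight of finite Haar integral**: for every Haar measure `μS` on `ker d₀ = {1}` there is a
`(Γ_T ⊓ ker d₀)`-covering weight `wS` with `∫ wS dμS < ∞` (★ `exists_isCoveringWeight_subgroupOf_of_measure_ne_top` with the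
representative set `univ`, of finite measure since `ker d₀` is a finite — one-point — compact group).
[cite: Folland1995, §2.6 Thm. 2.49] -/
theorem exists_isCoveringWeight_ker_diagUnitZero_two [MeasurableSpace (torusInBorel F E c 2)] [BorelSpace (torusInBorel F E c 2)]
    (μS : Measure (MonoidHom.mk' (fun t : torusInBorel F E c 2 => diagUnit (t : borelAdelic F E c 2).2 0)
      (fun t t' => diagUnit_torus_mul_two t t' 0)).ker) [IsHaarMeasure μS] :
    ∃ wS : (MonoidHom.mk' (fun t : torusInBorel F E c 2 => diagUnit (t : borelAdelic F E c 2).2 0)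
      (fun t t' => diagUnit_torus_mul_two t t' 0)).ker → ℝ≥0∞,
      IsCoveringWeight (((rationalBorel F E c 2).subgroupOf (torusInBorel F E c 2)).subgroupOf
        (MonoidHom.mk' (fun t : torusInBorel F E c 2 => diagUnit (t : borelAdelic F E c 2).2 0)
          (fun t t' => diagUnit_torus_mul_two t t' 0)).ker) wS ∧ ∫⁻ s, wS s ∂μS ≠ ∞ := by
  obtain ⟨hT1, hT2, hT3⟩ := locallyCompactSpace_secondCountable_t2_torusInBorel_two (F := F) (E := E) (c := c)
  haveI := discreteTopology_rationalTorusInBorel_two (F := F) (E := E) (c := c)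
  haveI := countable_rationalTorusInBorel (F := F) (E := E) (c := c) (N := 2)
  haveI := subsingleton_ker_diagUnitZeroHom_two (F := F) (E := E) (c := c)
  have hfin : μS univ ≠ ∞ := (isCompact_univ.measure_lt_top (μ := μS)).ne
  exact exists_isCoveringWeight_subgroupOf_of_measure_ne_top ((rationalBorel F E c 2).subgroupOf (torusInBorel F E c 2)) _ μS
    MeasurableSet.univ hfin (fun s => ⟨1, Subgroup.one_mem _, mem_univ _⟩)

end Fibre

/-! ## §3 The row: `∫_{T(F)∖T(𝔸_F)} G(d₀ t) dt = C · ∫_{Eˣ∖𝕀_E} G` for `U(J₂)` -/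

section Row

variable [MeasurableSpace (quasiSplit F E c 2).Adelic] [BorelSpace (quasiSplit F E c 2).Adelic]
  [MeasurableSpace (AdeleRing (𝓞 E) E)ˣ] [BorelSpace (AdeleRing (𝓞 E) E)ˣ]

/-- **TORUS-TO-IDELE UNFOLDING FOR `U(J₂)`.** For a quadratic `E/F` with involution `c` (`c² = 1`), Haar measures `μT` on
`T(𝔸_F) = torusInBorel F E c 2` and `μE` on `𝕀_E`: there is `C ∈ (0, ∞)` such that for every covering weight `w` of the rational
torus `Γ_T`, every covering weight `wE` of the principal ideles and every Borel `Eˣ`-invariant `G : 𝕀_E → [0, ∞]`,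
`∫⁻ G(d₀ t) w(t) dμT = C · ∫⁻ G(x) wE(x) dμE` — i.e. `∫_{T(F)∖T(𝔸_F)} G ∘ d₀ = C ∫_{Eˣ∖𝕀_E} G`: for `U(2)` the torus quotient
`MS∖M` IS the idele class group `E^*∖I_E` (★ `CoveringWeightsPushforward` at the isomorphism `α = d₀`).
[cite: Rogawski1990, §7.3 (p. 98) and Prop. 7.3.1 (p. 97)] [cite: Folland1995, §2.6 Thm. 2.49] -/
theorem exists_lintegral_comp_diagUnitZero_mul_weight_eq_two (hc : c * c = 1)
    (μT : Measure (torusInBorel F E c 2)) [IsHaarMeasure μT] (μE : Measure (AdeleRing (𝓞 E) E)ˣ) [IsHaarMeasure μE] :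
    ∃ C : ℝ≥0∞, C ≠ 0 ∧ C ≠ ∞ ∧ ∀ w : (torusInBorel F E c 2) → ℝ≥0∞,
      IsCoveringWeight ((rationalBorel F E c 2).subgroupOf (torusInBorel F E c 2)) w →
      ∀ wE : (AdeleRing (𝓞 E) E)ˣ → ℝ≥0∞, IsCoveringWeight (GaloisRepresentations.principalIdeles E) wE →
      ∀ G : (AdeleRing (𝓞 E) E)ˣ → ℝ≥0∞, Measurable G → (∀ k ∈ GaloisRepresentations.principalIdeles E, ∀ x, G (k * x) = G x) →
        ∫⁻ t, G (diagUnit (t : borelAdelic F E c 2).2 0) * w t ∂μT = C * ∫⁻ x, G x * wE x ∂μE := by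
  obtain ⟨hT1, hT2, hT3⟩ := locallyCompactSpace_secondCountable_t2_torusInBorel_two (F := F) (E := E) (c := c)
  obtain ⟨hI1, hI2, hI3⟩ := locallyCompactSpace_secondCountable_t2_idele (E := E)
  haveI := discreteTopology_rationalTorusInBorel_two (F := F) (E := E) (c := c)
  haveI := countable_rationalTorusInBorel (F := F) (E := E) (c := c) (N := 2)
  haveI : BorelSpace (torusInBorel F E c 2) := Subtype.borelSpace _
  haveI : IsClosed (((MonoidHom.mk' (fun t : torusInBorel F E c 2 => diagUnit (t : borelAdelic F E c 2).2 0)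
      (fun t t' => diagUnit_torus_mul_two t t' 0)).ker : Subgroup (torusInBorel F E c 2)) : Set (torusInBorel F E c 2)) := by
    haveI := t2Space_ideleGroup E
    rw [MonoidHom.coe_ker]
    exact isClosed_singleton.preimage continuous_diagUnitZeroHom_two
  letI : CommGroup (torusInBorel F E c 2) := { (inferInstance : Group (torusInBorel F E c 2)) with mul_comm := torusInBorel_comm }
  obtain ⟨wS, hwS, hfin⟩ := exists_isCoveringWeight_ker_diagUnitZero_two (F := F) (E := E) (c := c)
    (Measure.haar : Measure (MonoidHom.mk' (fun t : torusInBorel F E c 2 => diagUnit (t : borelAdelic F E c 2).2 0)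
      (fun t t' => diagUnit_torus_mul_two t t' 0)).ker)
  obtain ⟨C, hC0, hCt, hC⟩ := exists_lintegral_comp_mul_weight_eq_mul_lintegral
    (MonoidHom.mk' (fun t : torusInBorel F E c 2 => diagUnit (t : borelAdelic F E c 2).2 0)
      (fun t t' => diagUnit_torus_mul_two t t' 0)) ((rationalBorel F E c 2).subgroupOf (torusInBorel F E c 2))
    continuous_diagUnitZeroHom_two (isOpenMap_diagUnitZeroHom_two hc) (diagUnitZeroHom_two_surjective hc) μT μE
    (Measure.haar : Measure (MonoidHom.mk' (fun t : torusInBorel F E c 2 => diagUnit (t : borelAdelic F E c 2).2 0)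
      (fun t t' => diagUnit_torus_mul_two t t' 0)).ker) hwS hfin
  refine ⟨C, hC0, hCt, fun w hw wE hwE G hG hGinv => ?_⟩
  have hmap := map_rationalTorusInBorel_diagUnitZero_eq_principalIdeles_two (F := F) (E := E) (c := c) hc
  have hwE' : IsCoveringWeight (((rationalBorel F E c 2).subgroupOf (torusInBorel F E c 2)).map
      (MonoidHom.mk' (fun t : torusInBorel F E c 2 => diagUnit (t : borelAdelic F E c 2).2 0)
        (fun t t' => diagUnit_torus_mul_two t t' 0))) wE := by rw [hmap]; exact hwE
  have hGinv' : ∀ l ∈ ((rationalBorel F E c 2).subgroupOf (torusInBorel F E c 2)).map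
      (MonoidHom.mk' (fun t : torusInBorel F E c 2 => diagUnit (t : borelAdelic F E c 2).2 0)
        (fun t t' => diagUnit_torus_mul_two t t' 0)), ∀ x : (AdeleRing (𝓞 E) E)ˣ, G (l * x) = G x := by rw [hmap]; exact hGinv
  exact hC w hw wE hwE' G hG hGinv'

/-- **The same against an idele class domain** `𝓕 ⊆ 𝕀_E` (`IsIdeleClassDomain E 𝓕`): `∫⁻ G(d₀ t) w(t) dμT = C · ∫⁻_{𝓕} G dμE` for every
`Γ_T`-covering weight `w` and Borel `Eˣ`-invariant `G ≥ 0` — «the integral over `MS∖M = E^*∖I_E`» of the `U(2)` unipotent term in the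
tree's `𝓕`-currency. [cite: Rogawski1990, §7.3 (p. 98) and Prop. 7.3.1 (p. 97)] [cite: Folland1995, §2.6 Thm. 2.49] -/
theorem exists_lintegral_comp_diagUnitZero_mul_weight_eq_setLIntegral_two (hc : c * c = 1)
    (μT : Measure (torusInBorel F E c 2)) [IsHaarMeasure μT] (μE : Measure (AdeleRing (𝓞 E) E)ˣ) [IsHaarMeasure μE] :
    ∃ C : ℝ≥0∞, C ≠ 0 ∧ C ≠ ∞ ∧ ∀ w : (torusInBorel F E c 2) → ℝ≥0∞,
      IsCoveringWeight ((rationalBorel F E c 2).subgroupOf (torusInBorel F E c 2)) w →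
      ∀ 𝓕 : Set (AdeleRing (𝓞 E) E)ˣ, IsIdeleClassDomain E 𝓕 →
      ∀ G : (AdeleRing (𝓞 E) E)ˣ → ℝ≥0∞, Measurable G → (∀ k ∈ GaloisRepresentations.principalIdeles E, ∀ x, G (k * x) = G x) →
        ∫⁻ t, G (diagUnit (t : borelAdelic F E c 2).2 0) * w t ∂μT = C * ∫⁻ x in 𝓕, G x ∂μE := by
  obtain ⟨hT1, hT2, hT3⟩ := locallyCompactSpace_secondCountable_t2_torusInBorel_two (F := F) (E := E) (c := c)
  obtain ⟨hI1, hI2, hI3⟩ := locallyCompactSpace_secondCountable_t2_idele (E := E)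
  haveI := discreteTopology_rationalTorusInBorel_two (F := F) (E := E) (c := c)
  haveI := countable_rationalTorusInBorel (F := F) (E := E) (c := c) (N := 2)
  haveI : BorelSpace (torusInBorel F E c 2) := Subtype.borelSpace _
  haveI : IsClosed (((MonoidHom.mk' (fun t : torusInBorel F E c 2 => diagUnit (t : borelAdelic F E c 2).2 0)
      (fun t t' => diagUnit_torus_mul_two t t' 0)).ker : Subgroup (torusInBorel F E c 2)) : Set (torusInBorel F E c 2)) := by
    haveI := t2Space_ideleGroup E
    rw [MonoidHom.coe_ker]
    exact isClosed_singleton.preimage continuous_diagUnitZeroHom_two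
  letI : CommGroup (torusInBorel F E c 2) := { (inferInstance : Group (torusInBorel F E c 2)) with mul_comm := torusInBorel_comm }
  obtain ⟨wS, hwS, hfin⟩ := exists_isCoveringWeight_ker_diagUnitZero_two (F := F) (E := E) (c := c)
    (Measure.haar : Measure (MonoidHom.mk' (fun t : torusInBorel F E c 2 => diagUnit (t : borelAdelic F E c 2).2 0)
      (fun t t' => diagUnit_torus_mul_two t t' 0)).ker)
  obtain ⟨C, hC0, hCt, hC⟩ := exists_lintegral_comp_mul_weight_eq_mul_setLIntegral
    (MonoidHom.mk' (fun t : torusInBorel F E c 2 => diagUnit (t : borelAdelic F E c 2).2 0)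
      (fun t t' => diagUnit_torus_mul_two t t' 0)) ((rationalBorel F E c 2).subgroupOf (torusInBorel F E c 2))
    continuous_diagUnitZeroHom_two (isOpenMap_diagUnitZeroHom_two hc) (diagUnitZeroHom_two_surjective hc) μT μE
    (Measure.haar : Measure (MonoidHom.mk' (fun t : torusInBorel F E c 2 => diagUnit (t : borelAdelic F E c 2).2 0)
      (fun t t' => diagUnit_torus_mul_two t t' 0)).ker) hwS hfin
  refine ⟨C, hC0, hCt, fun w hw 𝓕 h𝓕 G hG hGinv => ?_⟩
  have hmap := map_rationalTorusInBorel_diagUnitZero_eq_principalIdeles_two (F := F) (E := E) (c := c) hc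
  have huniq : ∀ x : (AdeleRing (𝓞 E) E)ˣ,
      ∃! l : ((rationalBorel F E c 2).subgroupOf (torusInBorel F E c 2)).map
        (MonoidHom.mk' (fun t : torusInBorel F E c 2 => diagUnit (t : borelAdelic F E c 2).2 0)
          (fun t t' => diagUnit_torus_mul_two t t' 0)), l • x ∈ 𝓕 := by rw [hmap]; exact h𝓕.existsUnique
  have hGinv' : ∀ l ∈ ((rationalBorel F E c 2).subgroupOf (torusInBorel F E c 2)).map
      (MonoidHom.mk' (fun t : torusInBorel F E c 2 => diagUnit (t : borelAdelic F E c 2).2 0)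
        (fun t t' => diagUnit_torus_mul_two t t' 0)), ∀ x : (AdeleRing (𝓞 E) E)ˣ, G (l * x) = G x := by rw [hmap]; exact hGinv
  exact hC w hw 𝓕 h𝓕.measurableSet huniq G hG hGinv'

end Row

end UnitaryGroup

end Literature.NumberTheory.Automorphic
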